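import Summits.Ventures.YMGap.RobustBall.RobustAreaLawExplicit
import Summits.Ventures.YMGap.RobustBall.WilsonStringTension
import Summits.Ventures.YMGap.RobustBall.StaticPotentialOnBall
import HarnessLib

/-!
# Robust ball (Y2), area-law side — EXPLICIT STRING-TENSION FLOORS: uniform on the ball, and for the Wilson member at
every coupling of the slab-door window

HONEST FRAMING: venture file of the cell `pub-ymgap` (QuantumFields programme), track ROBUST-BALL, seat rb-p2 (g4).  LATTICE statements
about infinite-volume limit states (subsequential limits, on bounded continuous cylinder observables, of the perturbed TORUS states of a member
family `𝓦 = (W_L)_L`, `perturbedLimitPoints β 𝓦`; for `𝓦 = 0` exactly the tree's `infiniteVolumeLimitPoints` of the `SU(N)` Wilson action,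
tree coupling `β`, 't Hooft `β/N`, Wilson `β_W = 2β` for `SU(2)`).  «String tension» = the tree's `HasStringTension` / `stringTension`
(Wilson's criterion, Seiler LNP 159 §2).  WHAT IS NEW: the cell's area-law / string-tension theorems (`hasAreaLawWith_onBall`,
`stringTension_onBall`, `WilsonStringTension.su2_isConfining_dim4`, …) are qualitative («`∃ C, c > 0`»); here the SAME chain is run with the
explicit full-rate constants of `RobustAreaLawExplicit`, so every limit state of every member family obeys `HasAreaLawWith μ χ_N D c` with
`c = (−log c')/(r_W · mv)` EXPLICIT (`c' = max(c_row, θ)` the member's Dobrushin row constant floored at any `θ ∈ (0,1]`, `r_W = max(n r, 1)`,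
`mv` the vertical diameter) and has string tension `σ ≥ c` whenever `σ` exists; for the Wilson member `σ` exists at every `β > 0`
(`WilsonStringTension.stringTension_le`), so the floor is unconditional:
★ `SU(2)`, `d = n + 1`: `σ(μ) ≥ log(2/(n β_W))` for EVERY infinite-volume limit state at EVERY `0 < β_W ≤ 2/n` (`d = 4`: `log(2/(3β_W))` on
`(0, 2/3]`; `d = 3`: `log(1/β_W)` on `(0, 1]`) — the exact logarithmic slope of the strong-coupling series `σ = log(4/β_W) + O(β_W)` (character
expansion; Münster 1981, Drouffe–Zuber 1983), off by the additive constant `log(2n)` of the Dobrushin door only; every `N ≥ 2` ('t Hooft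
`R_s = 2n|β/N| ≤ 1/4`): `σ ≥ log((1/2 − R_s)/R_s)`.  WHAT IT IS NOT: the floors are DOOR ARTEFACTS (Dobrushin constants), not the physical string
tension; existence of `σ` is NOT claimed for non-Wilson members (no reflection positivity); nothing about the continuum, a spectral gap, or Clay.

References: K. Wilson, Phys. Rev. D 10 (1974) 2445; E. Seiler, LNP 159 (1982) §2; B. Durhuus, J. Fröhlich, CMP 75 (1980) 103;
Cao–Nissim–Sheffield arXiv:2509.04688v2 Thm 2.3; G. Münster, Nucl. Phys. B 180 (1981) 23 (strong-coupling series, for comparison only).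
-/

noncomputable section

open MeasureTheory Filter Topology
open Literature.Probability.LatticeModels (Site)
open Literature.MathematicalPhysics.QuantumLattice
open Literature.MathematicalPhysics.QuantumFieldTheory hiding ZdEdge Site
open Literature.MathematicalPhysics.QuantumFieldTheory.Balaban1983to89.StrongCouplingDobrushinWindow (OneLinkKRModulus)

namespace Summit.Ventures.YMGap.RobustBall

namespace StringTensionExplicit

variable {n N : ℕ}

/-! ### Shape bookkeeping -/

/-- `N · D^T · E ≤ D^{2(R+T)} · E` for `1 ≤ N ≤ D`, `E ≥ 0`, `R ≥ 1` (perimeter-type prefactor in the `HasAreaLawWith` shape). [folklore] -/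
theorem le_pow_perimeter_of_le {a Nr D E : ℝ} (hN1 : 1 ≤ Nr) (hND : Nr ≤ D) (hE : 0 ≤ E) {R T : ℕ} (hR : 1 ≤ R)
    (h : a ≤ Nr * D ^ T * E) : a ≤ D ^ (2 * (R + T)) * E := by
  refine h.trans (mul_le_mul_of_nonneg_right ?_ hE)
  have hD1 : 1 ≤ D := hN1.trans hND
  calc Nr * D ^ T ≤ D * D ^ T := mul_le_mul_of_nonneg_right hND (by positivity)
    _ = D ^ (T + 1) := by ring
    _ ≤ D ^ (2 * (R + T)) := pow_le_pow_right₀ hD1 (by omega)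

/-! ### The explicit area law and string-tension floor of every limit state of every member family -/

/-- **EXPLICIT `ℤ^d` AREA LAW OF EVERY LIMIT STATE ON THE BALL.**  `SU(N)`, `N ≥ 2`, dimension `n + 1 ≥ 2`, tree coupling `β`; one-link
modulus `OneLinkKRModulus N R K` on the slab ball `R ≥ 2n|β/N|`, `0 ≤ ε₁`, range `r`, vertical diameter `mv ≥ 1`, row condition
`c := e^{ε₀}(1 + 2√N ε₁)(2n|β/N|K) + √N ε₁ ≤ 1`, floor `0 < θ ≤ 1`, `c' = max(c, θ)`, `r_W = max(n r, 1)`.  Then EVERY infinite-volume limit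
state `μ` of EVERY family eventually in `ClusterDomainFR ε₀ ε₁ r ∩ IsSlabLocal mv` satisfies the tree's
`HasAreaLawWith μ χ_N (32N³/c') ((−log c')/(r_W · mv))`: `|W_μ(R',T)| ≤ (32N³/c')^{2(R'+T)} e^{−((−log c')/(r_W mv)) R' T}` for all `R', T ≥ 1`.
[folklore] -/
theorem hasAreaLawWith_onBall_explicit (hN : 2 ≤ N) (hn : 1 ≤ n) (β : ℝ) {R K : ℝ} (hK : 0 ≤ K)
    (hmod : OneLinkKRModulus N R K) (hR : |β / N| * (2 * (n : ℝ)) ≤ R) {ε₀ ε₁ : ℝ} (h₁ : 0 ≤ ε₁) (r : ℕ) {mv : ℕ}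
    (hmv : 1 ≤ mv) (hc : Real.exp ε₀ * (1 + 2 * Real.sqrt N * ε₁) * (2 * (n : ℝ) * |β / N| * K) + Real.sqrt N * ε₁ ≤ 1)
    {θ : ℝ} (hθ0 : 0 < θ) (hθ1 : θ ≤ 1) (𝓦 : PerturbationFamily (n + 1) N)
    (h𝓦 : ∀ᶠ L : ℕ in atTop, 𝓦 L ∈ ClusterDomainFR ε₀ ε₁ r ∧ IsSlabLocal mv (𝓦 L))
    {μ : Measure (LGConfig (n + 1) (SUN N))} (hμ : μ ∈ perturbedLimitPoints β 𝓦) :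
    haveI : NeZero (n + 1) := ⟨by omega⟩
    HasAreaLawWith μ (fun g => normalisedCharacter N (fundamentalRep (Fin N) g))
      (32 * (N : ℝ) ^ 3 / max (Real.exp ε₀ * (1 + 2 * Real.sqrt N * ε₁) * (2 * (n : ℝ) * |β / N| * K) + Real.sqrt N * ε₁) θ)
      (-Real.log (max (Real.exp ε₀ * (1 + 2 * Real.sqrt N * ε₁) * (2 * (n : ℝ) * |β / N| * K) + Real.sqrt N * ε₁) θ) /
        ((max (n * r) 1 : ℕ) * mv)) := by
  haveI : NeZero (n + 1) := ⟨by omega⟩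
  set c : ℝ := Real.exp ε₀ * (1 + 2 * Real.sqrt N * ε₁) * (2 * (n : ℝ) * |β / N| * K) + Real.sqrt N * ε₁ with hc_def
  have hc'0 : 0 < max c θ := lt_max_of_lt_right hθ0
  have hc'1 : max c θ ≤ 1 := max_le hc hθ1
  have hN1 : (1 : ℝ) ≤ N := by exact_mod_cast (show 1 ≤ N by omega)
  have hND : (N : ℝ) ≤ 32 * (N : ℝ) ^ 3 / max c θ := by
    rw [le_div_iff₀ hc'0]
    have h3 : (N : ℝ) ≤ (N : ℝ) ^ 3 := le_self_pow₀ hN1 (by norm_num)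
    nlinarith
  have h01 : (0 : Fin (n + 1)) ≠ 1 := fin_zero_ne_one_of_two_le (by omega)
  refine hasAreaLawWith_of_torusBound (β := β) (fun L => {W | W ∈ ClusterDomainFR ε₀ ε₁ r ∧ IsSlabLocal mv W})
    (fun L W hW R' T hR' _ hRL hTL => ?_) 𝓦 h𝓦 hμ
  have h := abs_expectation_wilsonLoop_le_onBall (n := n) hN β hK hmod hR h₁ r hmv hc hθ0 hθ1 (L + 1) W hW.1 hW.2
    (0 : Literature.MathematicalPhysics.QuantumFieldTheory.Site (n + 1) (L + 1)) h01 hRL hTL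
  exact le_pow_perimeter_of_le hN1 hND (Real.exp_pos _).le hR' h

/-- **EXPLICIT STRING-TENSION FLOOR ON THE BALL** (same data): every infinite-volume limit state `μ` of every family eventually in
`ClusterDomainFR ε₀ ε₁ r ∩ IsSlabLocal mv` has string tension `σ ≥ (−log c')/(r_W · mv)` WHENEVER its string tension exists
(`HasStringTension μ χ_N σ`; existence is not asserted for non-Wilson members), and its static potential, wherever it exists, is bounded
below by the same linear law: `HasStaticPotential μ χ_N R' V → ((−log c')/(r_W mv)) R' − log((32N³/c')²) ≤ V` (`R' ≥ 1`). [folklore] -/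
theorem stringTension_ge_onBall_explicit (hN : 2 ≤ N) (hn : 1 ≤ n) (β : ℝ) {R K : ℝ} (hK : 0 ≤ K)
    (hmod : OneLinkKRModulus N R K) (hR : |β / N| * (2 * (n : ℝ)) ≤ R) {ε₀ ε₁ : ℝ} (h₁ : 0 ≤ ε₁) (r : ℕ) {mv : ℕ}
    (hmv : 1 ≤ mv) (hc : Real.exp ε₀ * (1 + 2 * Real.sqrt N * ε₁) * (2 * (n : ℝ) * |β / N| * K) + Real.sqrt N * ε₁ ≤ 1)
    {θ : ℝ} (hθ0 : 0 < θ) (hθ1 : θ ≤ 1) (𝓦 : PerturbationFamily (n + 1) N)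
    (h𝓦 : ∀ᶠ L : ℕ in atTop, 𝓦 L ∈ ClusterDomainFR ε₀ ε₁ r ∧ IsSlabLocal mv (𝓦 L))
    {μ : Measure (LGConfig (n + 1) (SUN N))} (hμ : μ ∈ perturbedLimitPoints β 𝓦) :
    haveI : NeZero (n + 1) := ⟨by omega⟩
    (∀ σ : ℝ, HasStringTension μ (fun g => normalisedCharacter N (fundamentalRep (Fin N) g)) σ →
      -Real.log (max (Real.exp ε₀ * (1 + 2 * Real.sqrt N * ε₁) * (2 * (n : ℝ) * |β / N| * K) + Real.sqrt N * ε₁) θ) /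
        ((max (n * r) 1 : ℕ) * mv) ≤ σ) ∧
    (∀ (R' : ℕ) (V : ℝ), 1 ≤ R' → HasStaticPotential μ (fun g => normalisedCharacter N (fundamentalRep (Fin N) g)) R' V →
      -Real.log (max (Real.exp ε₀ * (1 + 2 * Real.sqrt N * ε₁) * (2 * (n : ℝ) * |β / N| * K) + Real.sqrt N * ε₁) θ) /
        ((max (n * r) 1 : ℕ) * mv) * R' -
        Real.log ((32 * (N : ℝ) ^ 3 / max (Real.exp ε₀ * (1 + 2 * Real.sqrt N * ε₁) * (2 * (n : ℝ) * |β / N| * K) +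
          Real.sqrt N * ε₁) θ) ^ 2) ≤ V) := by
  haveI : NeZero (n + 1) := ⟨by omega⟩
  have hA := hasAreaLawWith_onBall_explicit hN hn β hK hmod hR h₁ r hmv hc hθ0 hθ1 𝓦 h𝓦 hμ
  exact ⟨fun σ hσ => hA.le_of_hasStringTension hσ,
    fun R' V hR' hV => linear_le_of_hasAreaLawWith_of_hasStaticPotential hA hR' hV⟩

/-! ### The Wilson member: unconditional explicit floors (the string tension exists at every `β > 0`) -/

/-- **EXPLICIT WILSON STRING-TENSION FLOOR** (`SU(N)`, `N ≥ 2`, dimension `n + 1 ≥ 2`, tree coupling `β > 0`): from any one-link modulus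
`OneLinkKRModulus N R K` on the slab ball `R ≥ 2n|β/N|` with slab Dobrushin constant `c_W = 2n|β/N|K ≤ 1` and any floor `0 < θ ≤ 1`: EVERY
infinite-volume limit state `μ` of the torus Wilson states has a string tension (`WilsonStringTension.stringTension_le`) and
`stringTension μ χ_N ≥ −log max(c_W, θ)`. [folklore] -/
theorem wilson_stringTension_ge_explicit (hN : 2 ≤ N) (hn : 1 ≤ n) {β : ℝ} (hβ : 0 < β) {R K : ℝ} (hK : 0 ≤ K)
    (hmod : OneLinkKRModulus N R K) (hR : |β / N| * (2 * (n : ℝ)) ≤ R) (hc : 2 * (n : ℝ) * |β / N| * K ≤ 1)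
    {θ : ℝ} (hθ0 : 0 < θ) (hθ1 : θ ≤ 1) {μ : Measure (LGConfig (n + 1) (SUN N))}
    (hμ : haveI : NeZero (n + 1) := ⟨by omega⟩; μ ∈ infiniteVolumeLimitPoints (fundamentalRep (Fin N)) β) :
    haveI : NeZero (n + 1) := ⟨by omega⟩
    HasStringTension μ (fun g => normalisedCharacter N (fundamentalRep (Fin N) g))
        (stringTension μ (fun g => normalisedCharacter N (fundamentalRep (Fin N) g))) ∧
      -Real.log (max (2 * (n : ℝ) * |β / N| * K) θ) ≤
        stringTension μ (fun g => normalisedCharacter N (fundamentalRep (Fin N) g)) := by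
  haveI : NeZero (n + 1) := ⟨by omega⟩
  have hρ := TorusAreaLaw.isSpecialUnitaryModel_fundamentalRep N
  obtain ⟨-, hσ, -, -⟩ := WilsonStringTension.stringTension_le (fundamentalRep (Fin N)) hρ hN (by omega) hβ hμ
  refine ⟨hσ, ?_⟩
  have hmem : ∀ᶠ L : ℕ in atTop, (0 : PerturbationFamily (n + 1) N) L ∈ ClusterDomainFR 0 0 0 ∧
      IsSlabLocal 1 ((0 : PerturbationFamily (n + 1) N) L) :=
    Eventually.of_forall fun L => ⟨zero_mem_clusterDomainFR le_rfl le_rfl 0, isSlabLocal_zero 1 (L + 1)⟩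
  have hμ' : μ ∈ perturbedLimitPoints β (0 : PerturbationFamily (n + 1) N) := by rwa [perturbedLimitPoints_zero]
  have h := (stringTension_ge_onBall_explicit hN hn β hK hmod hR le_rfl 0 le_rfl (ε₀ := 0) (ε₁ := 0) (by simpa using hc)
    hθ0 hθ1 0 hmem hμ').1 _ hσ
  simpa using h

/-- ★ **`SU(2)`: THE STRING TENSION IS AT LEAST `log(2/(n β_W))` AT EVERY WILSON COUPLING `0 < β_W ≤ 2/n`** (dimension `d = n + 1 ≥ 2`,
tree coupling `β_W/2`, quarter modulus `K = 1`, slab Dobrushin constant `n β_W/2`): for EVERY infinite-volume limit state `μ` of the torus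
Wilson states, `σ(μ) = stringTension μ χ₂` exists and `σ(μ) ≥ log(2/(n β_W))` — the exact logarithmic slope of the strong-coupling series
`σ = log(4/β_W) + O(β_W)`, off by the door's additive constant `log(2n)`. [folklore] -/
theorem su2_stringTension_ge_log (hn : 1 ≤ n) {βW : ℝ} (hβ : 0 < βW) (hβ1 : (n : ℝ) * βW ≤ 2)
    {μ : Measure (LGConfig (n + 1) (SUN 2))}
    (hμ : haveI : NeZero (n + 1) := ⟨by omega⟩; μ ∈ infiniteVolumeLimitPoints (fundamentalRep (Fin 2)) (βW / 2)) :
    haveI : NeZero (n + 1) := ⟨by omega⟩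
    HasStringTension μ (fun g => normalisedCharacter 2 (fundamentalRep (Fin 2) g))
        (stringTension μ (fun g => normalisedCharacter 2 (fundamentalRep (Fin 2) g))) ∧
      Real.log (2 / ((n : ℝ) * βW)) ≤ stringTension μ (fun g => normalisedCharacter 2 (fundamentalRep (Fin 2) g)) := by
  haveI : NeZero (n + 1) := ⟨by omega⟩
  have hnpos : (0 : ℝ) < n := by exact_mod_cast (show 0 < n by omega)
  have habs : |βW / 2 / (2 : ℕ)| = βW / 4 := by rw [abs_of_nonneg (by positivity)]; push_cast; ring
  have hcW : 2 * (n : ℝ) * |βW / 2 / (2 : ℕ)| * 1 = n * βW / 2 := by rw [habs]; ring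
  have hmod := SlabAreaLawDimensions.su2_oneLinkKRModulus_of_le_one (R := (n : ℝ) * βW / 2) (by linarith)
  have hθ0 : 0 < (n : ℝ) * βW / 2 := by positivity
  have hθ1 : (n : ℝ) * βW / 2 ≤ 1 := by linarith
  obtain ⟨hσ, h⟩ := wilson_stringTension_ge_explicit (n := n) (N := 2) le_rfl hn (by positivity) zero_le_one hmod
    (by rw [habs]; linarith) (by rw [hcW]; exact hθ1) hθ0 hθ1 hμ
  refine ⟨hσ, ?_⟩
  rw [hcW, max_self] at h
  have hlog : Real.log (2 / ((n : ℝ) * βW)) = -Real.log ((n : ℝ) * βW / 2) := by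
    rw [← Real.log_inv]; congr 1; field_simp
  rw [hlog]; exact h

/-- ★ **`SU(2)`, `d = 4`: `σ(μ) ≥ log(2/(3β_W))` for every infinite-volume limit state at every `0 < β_W ≤ 2/3`** (e.g. `β_W = 1/8`:
`σ ≥ log(16/3) ≥ 1.67`; `β_W = 1/3`: `σ ≥ log 2 ≥ 0.69`; `β_W = 1/2`: `σ ≥ log(4/3) ≥ 0.28`; lattice units). [folklore] -/
theorem su2_stringTension_ge_log_dim4 {βW : ℝ} (hβ : 0 < βW) (hβ1 : βW ≤ 2 / 3) {μ : Measure (LGConfig 4 (SUN 2))}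
    (hμ : μ ∈ infiniteVolumeLimitPoints (fundamentalRep (Fin 2)) (βW / 2)) :
    HasStringTension μ (fun g => normalisedCharacter 2 (fundamentalRep (Fin 2) g))
        (stringTension μ (fun g => normalisedCharacter 2 (fundamentalRep (Fin 2) g))) ∧
      Real.log (2 / (3 * βW)) ≤ stringTension μ (fun g => normalisedCharacter 2 (fundamentalRep (Fin 2) g)) := by
  have h := su2_stringTension_ge_log (n := 3) (by norm_num) hβ (by push_cast; linarith) hμ
  push_cast at h
  exact h

/-- ★ **`SU(2)`, `d = 3`: `σ(μ) ≥ log(1/β_W)` for every infinite-volume limit state at every `0 < β_W ≤ 1`.** [folklore] -/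
theorem su2_stringTension_ge_log_dim3 {βW : ℝ} (hβ : 0 < βW) (hβ1 : βW ≤ 1) {μ : Measure (LGConfig 3 (SUN 2))}
    (hμ : μ ∈ infiniteVolumeLimitPoints (fundamentalRep (Fin 2)) (βW / 2)) :
    HasStringTension μ (fun g => normalisedCharacter 2 (fundamentalRep (Fin 2) g))
        (stringTension μ (fun g => normalisedCharacter 2 (fundamentalRep (Fin 2) g))) ∧
      Real.log (1 / βW) ≤ stringTension μ (fun g => normalisedCharacter 2 (fundamentalRep (Fin 2) g)) := by
  have h := su2_stringTension_ge_log (n := 2) (by norm_num) hβ (by push_cast; linarith) hμ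
  push_cast at h
  have e : (2 : ℝ) / (2 * βW) = 1 / βW := by field_simp
  rw [e] at h
  exact h

/-- ★ **Every `N ≥ 2`, hypothesis-free (Bakry–Émery modulus): `σ(μ) ≥ log((1/2 − R_s)/R_s)`** for every infinite-volume limit state of
the `SU(N)` torus Wilson states at tree coupling `β > 0` with slab radius `R_s = 2n|β/N| ≤ 1/4` ('t Hooft `|β/N| ≤ 1/(8n)`; dimension `n + 1`;
`d = 4`: `|β/N| ≤ 1/24`). [cite: arXiv220412737, Lemma 4.1] -/
theorem suN_stringTension_ge_log (hN : 2 ≤ N) (hn : 1 ≤ n) {β : ℝ} (hβ : 0 < β) (hR : |β / N| * (2 * (n : ℝ)) ≤ 1 / 4)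
    {μ : Measure (LGConfig (n + 1) (SUN N))}
    (hμ : haveI : NeZero (n + 1) := ⟨by omega⟩; μ ∈ infiniteVolumeLimitPoints (fundamentalRep (Fin N)) β) :
    haveI : NeZero (n + 1) := ⟨by omega⟩
    HasStringTension μ (fun g => normalisedCharacter N (fundamentalRep (Fin N) g))
        (stringTension μ (fun g => normalisedCharacter N (fundamentalRep (Fin N) g))) ∧
      Real.log ((1 / 2 - |β / N| * (2 * (n : ℝ))) / (|β / N| * (2 * (n : ℝ)))) ≤
        stringTension μ (fun g => normalisedCharacter N (fundamentalRep (Fin N) g)) := by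
  haveI : NeZero (n + 1) := ⟨by omega⟩
  set Rs : ℝ := |β / N| * (2 * (n : ℝ)) with hRs
  have hNpos : (0 : ℝ) < N := by exact_mod_cast (show 0 < N by omega)
  have hnpos : (0 : ℝ) < n := by exact_mod_cast (show 0 < n by omega)
  have hRpos : 0 < Rs := by
    have : 0 < |β / N| := abs_pos.2 (div_ne_zero hβ.ne' hNpos.ne')
    positivity
  have hlt : Rs < 1 / 2 := by linarith
  have hpos : 0 < 1 / 2 - Rs := by linarith
  have hK : 0 ≤ 1 / (1 / 2 - Rs) := by positivity
  have hmod := Balaban1983to89.StrongCouplingKernelWindow.oneLinkKRModulus_SU hN hlt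
  have hcW : 2 * (n : ℝ) * |β / N| * (1 / (1 / 2 - Rs)) = Rs / (1 / 2 - Rs) := by rw [hRs]; ring
  have hθ0 : 0 < Rs / (1 / 2 - Rs) := div_pos hRpos hpos
  have hθ1 : Rs / (1 / 2 - Rs) ≤ 1 := by rw [div_le_one hpos]; linarith
  obtain ⟨hσ, h⟩ := wilson_stringTension_ge_explicit (n := n) hN hn hβ hK hmod le_rfl (by rw [hcW]; exact hθ1) hθ0 hθ1 hμ
  refine ⟨hσ, ?_⟩
  rw [hcW, max_self] at h
  have hlog : Real.log ((1 / 2 - Rs) / Rs) = -Real.log (Rs / (1 / 2 - Rs)) := by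
    rw [← Real.log_inv, inv_div]
  rw [hlog]; exact h

/-! ### The Wilson member: explicit LINEAR lower bound of the static quark potential -/

/-- **EXPLICIT LINEAR CONFINEMENT OF THE WILSON STATIC POTENTIAL** (`SU(N)`, `N ≥ 2`, dimension `n + 1 ≥ 2`, tree coupling `β > 0`, any
one-link modulus with slab Dobrushin constant `c_W = 2n|β/N|K ≤ 1`, floor `0 < θ ≤ 1`, `c' = max(c_W, θ)`): for every infinite-volume limit
state `μ` of the torus Wilson states and every separation `R' ≥ 1`, the static potential `V(R') = staticPotential μ χ_N R'` exists
(`WilsonStringTension.hasStaticPotential`) and `V(R') ≥ (−log c')·R' − log((32N³/c')²)`. [folklore] -/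
theorem wilson_staticPotential_ge_explicit (hN : 2 ≤ N) (hn : 1 ≤ n) {β : ℝ} (hβ : 0 < β) {R K : ℝ} (hK : 0 ≤ K)
    (hmod : OneLinkKRModulus N R K) (hR : |β / N| * (2 * (n : ℝ)) ≤ R) (hc : 2 * (n : ℝ) * |β / N| * K ≤ 1)
    {θ : ℝ} (hθ0 : 0 < θ) (hθ1 : θ ≤ 1) {μ : Measure (LGConfig (n + 1) (SUN N))}
    (hμ : haveI : NeZero (n + 1) := ⟨by omega⟩; μ ∈ infiniteVolumeLimitPoints (fundamentalRep (Fin N)) β)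
    (R' : ℕ) (hR' : 1 ≤ R') :
    haveI : NeZero (n + 1) := ⟨by omega⟩
    HasStaticPotential μ (fun g => normalisedCharacter N (fundamentalRep (Fin N) g)) R'
        (staticPotential μ (fun g => normalisedCharacter N (fundamentalRep (Fin N) g)) R') ∧
      -Real.log (max (2 * (n : ℝ) * |β / N| * K) θ) * R' -
          Real.log ((32 * (N : ℝ) ^ 3 / max (2 * (n : ℝ) * |β / N| * K) θ) ^ 2) ≤
        staticPotential μ (fun g => normalisedCharacter N (fundamentalRep (Fin N) g)) R' := by
  haveI : NeZero (n + 1) := ⟨by omega⟩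
  have hρ := TorusAreaLaw.isSpecialUnitaryModel_fundamentalRep N
  have hV := WilsonStringTension.hasStaticPotential (fundamentalRep (Fin N)) hρ hN (by omega) hβ hμ R'
  refine ⟨hV, ?_⟩
  have hmem : ∀ᶠ L : ℕ in atTop, (0 : PerturbationFamily (n + 1) N) L ∈ ClusterDomainFR 0 0 0 ∧
      IsSlabLocal 1 ((0 : PerturbationFamily (n + 1) N) L) :=
    Eventually.of_forall fun L => ⟨zero_mem_clusterDomainFR le_rfl le_rfl 0, isSlabLocal_zero 1 (L + 1)⟩
  have hμ' : μ ∈ perturbedLimitPoints β (0 : PerturbationFamily (n + 1) N) := by rwa [perturbedLimitPoints_zero]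
  have h := (stringTension_ge_onBall_explicit hN hn β hK hmod hR le_rfl 0 le_rfl (ε₀ := 0) (ε₁ := 0) (by simpa using hc)
    hθ0 hθ1 0 hmem hμ').2 R' _ hR' hV
  simpa using h

/-- ★ **`SU(2)`, `d = 4`: the static quark potential of every infinite-volume limit state at `0 < β_W ≤ 2/3` is bounded below by the
explicit linear law `V(R') ≥ log(2/(3β_W))·R' − 2·log(512/(3β_W))` for every `R' ≥ 1`** (slope = the string-tension floor; the intercept is
the perimeter constant of the door). [folklore] -/
theorem su2_staticPotential_ge_dim4 {βW : ℝ} (hβ : 0 < βW) (hβ1 : βW ≤ 2 / 3) {μ : Measure (LGConfig 4 (SUN 2))}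
    (hμ : μ ∈ infiniteVolumeLimitPoints (fundamentalRep (Fin 2)) (βW / 2)) (R' : ℕ) (hR' : 1 ≤ R') :
    HasStaticPotential μ (fun g => normalisedCharacter 2 (fundamentalRep (Fin 2) g)) R'
        (staticPotential μ (fun g => normalisedCharacter 2 (fundamentalRep (Fin 2) g)) R') ∧
      Real.log (2 / (3 * βW)) * R' - 2 * Real.log (512 / (3 * βW)) ≤
        staticPotential μ (fun g => normalisedCharacter 2 (fundamentalRep (Fin 2) g)) R' := by
  have habs : |βW / 2 / ((2 : ℕ) : ℝ)| = βW / 4 := by rw [abs_of_nonneg (by positivity)]; push_cast; ring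
  have hcW : 2 * ((3 : ℕ) : ℝ) * |βW / 2 / ((2 : ℕ) : ℝ)| * 1 = 3 * βW / 2 := by rw [habs]; push_cast; ring
  have hmod := SlabAreaLawDimensions.su2_oneLinkKRModulus_of_le_one (R := 3 * βW / 2) (by linarith)
  have hθ0 : 0 < 3 * βW / 2 := by positivity
  have hθ1 : 3 * βW / 2 ≤ 1 := by linarith
  obtain ⟨hV, h⟩ := wilson_staticPotential_ge_explicit (n := 3) (N := 2) le_rfl (by norm_num) (by positivity) zero_le_one
    hmod (by rw [habs]; push_cast; linarith) (by rw [hcW]; exact hθ1) hθ0 hθ1 hμ R' hR'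
  refine ⟨hV, ?_⟩
  rw [hcW, max_self] at h
  have hlog : Real.log (2 / (3 * βW)) = -Real.log (3 * βW / 2) := by
    rw [← Real.log_inv]; congr 1; field_simp
  have hD : (32 * ((2 : ℕ) : ℝ) ^ 3 / (3 * βW / 2)) = 512 / (3 * βW) := by push_cast; field_simp; ring
  have hlog2 : Real.log ((512 / (3 * βW)) ^ 2) = 2 * Real.log (512 / (3 * βW)) := by
    rw [Real.log_pow]; push_cast; ring
  rw [hD, hlog2] at h
  rw [hlog]
  exact h

/-! ### Certified cells: `SU(2)`, `d = 4`, the sprint's ball of record at `β_W = 1/8` -/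

/-- `e^{37/125} ≤ 269/200` (Taylor to order 4 with remainder). [folklore] -/
theorem exp_37_125_le : Real.exp (37 / 125 : ℝ) ≤ 269 / 200 := by
  have h := Real.exp_bound (x := (37 / 125 : ℝ)) (by norm_num) (n := 4) (by norm_num)
  have hsum : ∑ i ∈ Finset.range 4, (37 / 125 : ℝ) ^ i / (i.factorial : ℝ) = 7875764 / 5859375 := by
    simp [Finset.sum_range_succ, Nat.factorial]; norm_num
  rw [hsum] at h
  have h' := (abs_le.1 h).2
  have : |(37 / 125 : ℝ)| ^ 4 * ((Nat.succ 4 : ℕ) / ((Nat.factorial 4 : ℕ) * (4 : ℕ) : ℝ)) = 1874161 / 4687500000 := by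
    norm_num [Nat.factorial]
  rw [this] at h'
  linarith

/-- The Dobrushin row constant of the sprint ball `(β_W, ε₀, ε₁) = (1/8, 37/125, 37/250)` (`SU(2)`, `d = 4`, `K = 1`) is at most `57/100`:
`e^{37/125}(1 + 2√2·37/250)(3/16) + √2·37/250 ≤ 1.345·1.4189·0.1875 + 0.2095 ≤ 0.5673`. [folklore] -/
theorem sprintBall_rowConst_le :
    Real.exp (37 / 125) * (1 + 2 * Real.sqrt 2 * (37 / 250)) * (2 * (3 : ℝ) * |(1 / 16 : ℝ) / 2| * 1) +
      Real.sqrt 2 * (37 / 250) ≤ 57 / 100 := by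
  have he := exp_37_125_le
  have hs := sqrt_two_le_1415
  have he0 : 0 < Real.exp (37 / 125 : ℝ) := Real.exp_pos _
  have hs0 : 0 ≤ Real.sqrt 2 := Real.sqrt_nonneg _
  have habs : |(1 / 16 : ℝ) / 2| = 1 / 32 := by rw [abs_of_nonneg (by positivity)]; norm_num
  rw [habs]
  nlinarith [mul_nonneg he0.le hs0, mul_le_mul he hs hs0 (by norm_num)]

/-- ★ **STRING-TENSION FLOOR ON THE SPRINT'S BALL OF RECORD** (`SU(2)`, `d = 4`, `β_W = 1/8`, tier-1 ball `(ε₀, ε₁) = (37/125, 37/250)` —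
the radii of ds-2's `su2_massGapOnBallZdG_star_oneEighth` — any range `r`, any vertical window `mv ≥ 1`): every infinite-volume limit state
`μ` of every eventually-member family has `HasAreaLawWith μ χ₂ (25600/57) …`-type area law with RATE `log(100/57)/(max(3r,1)·mv)` and string
tension `σ ≥ log(100/57)/(max(3r,1)·mv)` (`log(100/57) ≥ 0.56`) whenever `σ` exists. [folklore] -/
theorem su2_stringTension_ge_sprintBall (r : ℕ) {mv : ℕ} (hmv : 1 ≤ mv) (𝓦 : PerturbationFamily 4 2)
    (h𝓦 : ∀ᶠ L : ℕ in atTop, 𝓦 L ∈ ClusterDomainFR (37 / 125) (37 / 250) r ∧ IsSlabLocal mv (𝓦 L))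
    {μ : Measure (LGConfig 4 (SUN 2))} (hμ : μ ∈ perturbedLimitPoints (1 / 16) 𝓦) :
    ∀ σ : ℝ, HasStringTension μ (fun g => normalisedCharacter 2 (fundamentalRep (Fin 2) g)) σ →
      Real.log (100 / 57) / ((max (3 * r) 1 : ℕ) * mv) ≤ σ := by
  have hmod := SlabAreaLawDimensions.su2_oneLinkKRModulus_of_le_one (R := 3 / 16) (by norm_num)
  have habs : |(1 / 16 : ℝ) / (2 : ℕ)| = 1 / 32 := by rw [abs_of_nonneg (by positivity)]; norm_num
  have hc1 : Real.exp (37 / 125) * (1 + 2 * Real.sqrt (2 : ℕ) * (37 / 250)) * (2 * ((3 : ℕ) : ℝ) * |(1 / 16 : ℝ) / (2 : ℕ)| * 1) +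
      Real.sqrt (2 : ℕ) * (37 / 250) ≤ 1 := by
    have := sprintBall_rowConst_le; push_cast; linarith
  have h := (stringTension_ge_onBall_explicit (n := 3) (N := 2) le_rfl (by norm_num) (1 / 16) zero_le_one hmod
    (by rw [habs]; norm_num) (by norm_num) r hmv hc1 (θ := 57 / 100) (by norm_num) (by norm_num) 𝓦 h𝓦 hμ).1
  push_cast at h
  rw [max_eq_right sprintBall_rowConst_le] at h
  intro σ hσ
  have h' := h σ hσ
  have hlog : Real.log (100 / 57) = -Real.log (57 / 100) := by
    rw [← Real.log_inv]; norm_num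
  rw [hlog]
  exact_mod_cast h'

/-- ★ **The Wilson member at the sprint point `β_W = 1/8` (`SU(2)`, `d = 4`): every infinite-volume limit state has string tension
`σ(μ) ≥ log(16/3) ≥ 1.67`** (strong-coupling series value `≈ log 32 ≈ 3.47`; lattice units). [folklore] -/
theorem su2_stringTension_ge_oneEighth {μ : Measure (LGConfig 4 (SUN 2))}
    (hμ : μ ∈ infiniteVolumeLimitPoints (fundamentalRep (Fin 2)) (1 / 16)) :
    Real.log (16 / 3) ≤ stringTension μ (fun g => normalisedCharacter 2 (fundamentalRep (Fin 2) g)) := by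
  have h := (su2_stringTension_ge_log_dim4 (βW := 1 / 8) (by norm_num) (by norm_num) (by norm_num; exact hμ)).2
  norm_num at h
  exact h

end StringTensionExplicit

end Summit.Ventures.YMGap.RobustBall
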